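/-
Copyright (c) 2026 the pub-hodgecm-mathlib formalisation cell (harness21).  Prover seat hodgecm-mathlib-K2E1-p16 (g2), Track B «K2-LIT» ENGINE E1, h413 = `stmt-HodgeConjecture-24833`,
route `HCCMUnconditional`, R90-S8 «ContSpec-n½» TWIN-DAG row 8 (dealer R90-CS-plan (g2), S8-R19 (F)) — THE GENERAL-LEVEL PRINT AT `N = 3`, the twin of ★
`K2E1ChiEisensteinMeromorphicExportsLevelCMTwo` (K2-defs1).
-/
import Summits.HodgeConjecture.HodgeConjecture.Theorems.K2E1ChiEisensteinMeromorphicExportsU3GlobalCMEigen   -- ★ row 6 EIGEN (this seat): X2_χ (A) CM print at `N = 3`, eigenvalue currency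
import Summits.HodgeConjecture.HodgeConjecture.Theorems.K2E1ChiConvDataLevelCMThree                        -- ★ row 7b (K2E1-p14, p862190): the general-level ball data `exists_chi_convData_level_cm_three`
import Summits.HodgeConjecture.HodgeConjecture.Theorems.K2E1ChiEisensteinMeromorphicExportsM1CMThree        -- ★ row 8 M1 (this seat): `one_apply_torus`, `isAutomorphic_one`, `exists_scatteringCoords_of_basis_cm_three_one`
import HarnessLib

/-!
# h413 ∕ Track B «K2-LIT», R90-S8 TWIN-DAG row 8 — `K2E1ChiEisensteinMeromorphicExportsLevelCMThree`: THE `(χ, τ)` EISENSTEIN EXPORTS OF `U(2,1)_{L∕L⁺}` AT A GENERAL LEVEL —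
# MEROMORPHIC CONTINUATION OF `E(f_z^φ)` AND OF ITS SCATTERING COORDINATES FOR `φ ∈ V(χ, K′, ω)`, `K′` ANY LEVEL WITH `ι(K_∞) ⊆ K′ ≤ K` AND AN OPEN COMPACT `U₀`-PART ACTING TRIVIALLY —
# every `(χ_∞, ω)`, both letter families PAID

Cell `pub/hodgecm-mathlib`, crux H413 = `stmt-HodgeConjecture-24833`; dealer R90-CS-plan (g2) S8-R19 (F) «row 8 = K2E1-p16».  THEOREMS ONLY (no `def`, no `instance`, no notation, no
named-fact hypothesis, no `sorry`); lane `--kind proof --supports stmt-HodgeConjecture-24833 --as helper` (count-neutral).  Closes no socket.  The token-for-token `N = 3` twin of ★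
`K2E1ChiEisensteinMeromorphicExportsLevelCMTwo.chiEisenstein_meromorphic_exports_level_cm_two` (K2-defs1): `2 ↦ 3`, `{1 < Re} ↦ {2 < Re}`, `z − 1 ↦ z − 2`, `P ⊆ {Re ≤ 2}`; ONE call of ★
row 6 EIGEN `chiEisenstein_meromorphic_exports_cm_three_of_letters_of_eigen` (pair currency at `χ₂ = 1`, `V := chiSectionSpace χ K′ ω` — ★ `IsChiSection.isChiSectionPair_of_trivial`, ★
`isAutomorphic_one`) with `hCD := exists_chi_convData_level_cm_three` (★ row 7b, K2E1-p14) and `hq`∕`hqφ` from ★ row 8 M1 §1 `exists_scatteringCoords_of_basis_cm_three_one`.  Structural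
binders left: `hK'`, `hKinf`, `U₀` open compact with `hU`, `hVc`, a basis `bV` of `V(χʷ, K′, ω)` by continuous bounded functions, and two auxiliary Haar measures (`μ_∞` two-sided on `G_∞`,
`μ_f` on `G(𝔸_f)`; proof-only).  [BernsteinLapid2019, Thm 2.3, §4, §7; MoeglinWaldspurger1995, II.1.7, IV.1.8–11]
* HEAD **`chiEisenstein_meromorphic_exports_level_cm_three`** (conclusion byte-identical with the M1 print's: `q` holomorphic on `{2 < Re}` with `hqφ`, and (E1)–(E4)).
HONEST LABEL: HC_CM is proved only modulo the 7 printed citations (2 remaining named inputs: hLiu418 = `stmt-HodgeConjecture-24832`, h413 = `stmt-HodgeConjecture-24833`) until rung 0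
closes; count-neutral helper, closes no socket.

## References
* [BernsteinLapid2019] J. Bernstein, E. Lapid, *On the meromorphic continuation of Eisenstein series*, J. AMS 37 (2024), Thm 2.3, §4, §7.
* [MoeglinWaldspurger1995] C. Mœglin, J.-L. Waldspurger, *Spectral Decomposition and Eisenstein Series* (1995), II.1.7, IV.1.8–IV.1.11.
-/

set_option autoImplicit false
set_option linter.dupNamespace false  -- the mandated namespace repeats the summit's segment (`HodgeConjecture.HodgeConjecture`)

noncomputable section

open MeasureTheory Measure Filter Topology Set NumberField IsDedekindDomain
open scoped NNReal ENNReal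
open Literature.MeasureTheory.Group Literature.NumberTheory Literature.NumberTheory.Automorphic Literature.NumberTheory.Automorphic.UnitaryGroup AdelicGroupData
open Literature.NumberTheory.Automorphic.Arthur2013.Leaves.TECR
open Literature.NumberTheory.GaloisRepresentations (HeckeCharacter)
open Summit.HodgeConjecture.HodgeConjecture.Cruxes.H413.K2E1BorelEisensteinU
open Summit.HodgeConjecture.HodgeConjecture.Cruxes.H413.K2E1BLBorelSpacesU2Defs
open Summit.HodgeConjecture.HodgeConjecture.Cruxes.H413.K2E1BLBorelOperatorsU2Defs
open Summit.HodgeConjecture.HodgeConjecture.Cruxes.H413.K2E1CharacterEisensteinU2Defs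
open Summit.HodgeConjecture.HodgeConjecture.Cruxes.H413.K2E1ChiSectionSpaceU2Defs
open Summit.HodgeConjecture.HodgeConjecture.Cruxes.H413.K2E1ChiEisensteinMeromorphicExportsU3GlobalCMEigen (chiEisenstein_meromorphic_exports_cm_three_of_letters_of_eigen)
open Summit.HodgeConjecture.HodgeConjecture.Cruxes.H413.K2E1ChiConvDataLevelCMThree (exists_chi_convData_level_cm_three)
open Summit.HodgeConjecture.HodgeConjecture.Cruxes.H413.K2E1ChiEisensteinMeromorphicExportsM1CMThree (one_apply_torus isAutomorphic_one exists_scatteringCoords_of_basis_cm_three_one)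
open Summit.HodgeConjecture.HodgeConjecture.Cruxes.H413.K2E1CharacterEisensteinU3PairDefs (IsChiSectionPair IsChiSection.isChiSectionPair_of_trivial)

namespace Summit.HodgeConjecture.HodgeConjecture.Cruxes.H413.K2E1ChiEisensteinMeromorphicExportsLevelCMThree

variable (L : Type) [Field L] [NumberField L] [IsCMField L]
  [MeasurableSpace (quasiSplit (↥(maximalRealSubfield L)) L (IsCMField.complexConj L) 3).Adelic] [BorelSpace (quasiSplit (↥(maximalRealSubfield L)) L (IsCMField.complexConj L) 3).Adelic]
  [MeasurableSpace (arch (↥(maximalRealSubfield L)) L (IsCMField.complexConj L) 3 ((StdForm.antidiagonal 3).over L))] [BorelSpace (arch (↥(maximalRealSubfield L)) L (IsCMField.complexConj L) 3 ((StdForm.antidiagonal 3).over L))]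
  [MeasurableSpace (finAdelic (↥(maximalRealSubfield L)) L (IsCMField.complexConj L) 3 ((StdForm.antidiagonal 3).over L))] [BorelSpace (finAdelic (↥(maximalRealSubfield L)) L (IsCMField.complexConj L) 3 ((StdForm.antidiagonal 3).over L))]

/-- **THE GENERAL-LEVEL PRINT — MEROMORPHIC CONTINUATION OF `E(f_z^φ)` AND OF ITS SCATTERING COORDINATES FOR `φ ∈ V(χ, K′, ω)`** (module docstring): holomorphic scattering coordinates
`q_j` on `{2 < Re}` (★ row 8 M1 §1 `exists_scatteringCoords_of_basis_cm_three_one`), and (E1)–(E4) from ★ row 6 X2_χ (A)-eigen fed with ★ row 7b `exists_chi_convData_level_cm_three`. [cite: BernsteinLapid2019, Thm 2.3, §4, §7] [cite: MoeglinWaldspurger1995, II.1.7, IV.1.8–IV.1.11] -/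
theorem chiEisenstein_meromorphic_exports_level_cm_three
    (μ : Measure (quasiSplit (↥(maximalRealSubfield L)) L (IsCMField.complexConj L) 3).automorphicQuotient) [(quasiSplit (↥(maximalRealSubfield L)) L (IsCMField.complexConj L) 3).IsAutomorphicMeasure μ]
    (νG : Measure (quasiSplit (↥(maximalRealSubfield L)) L (IsCMField.complexConj L) 3).Adelic) [νG.IsHaarMeasure] [νG.IsInvInvariant] [SFinite νG]
    (ν : Measure ↥(adelicUnipotent (↥(maximalRealSubfield L)) L (IsCMField.complexConj L) 3)) [ν.IsHaarMeasure] [ν.IsMulRightInvariant] [ν.IsInvInvariant]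
    {𝓕 : Set ↥(adelicUnipotent (↥(maximalRealSubfield L)) L (IsCMField.complexConj L) 3)}
    (h𝓕N : IsFundamentalDomain ↥(rationalUnipotent (↥(maximalRealSubfield L)) L (IsCMField.complexConj L) 3) 𝓕 ν) (h𝓕c : IsCompact (closure 𝓕)) (h𝓕₀ : ν 𝓕 ≠ 0)
    {β : (quasiSplit (↥(maximalRealSubfield L)) L (IsCMField.complexConj L) 3).Adelic → ℝ≥0∞}
    (hβ : IsCoveringWeight ↥((arithmeticBorel (↥(maximalRealSubfield L)) L (IsCMField.complexConj L) 3).map (quasiSplit (↥(maximalRealSubfield L)) L (IsCMField.complexConj L) 3).arithmeticSubgroup.subtype) β)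
    {μZ : Measure (borelQuotient (↥(maximalRealSubfield L)) L (IsCMField.complexConj L) 3)} [SFinite μZ]
    (hμZ : ∀ f : borelQuotient (↥(maximalRealSubfield L)) L (IsCMField.complexConj L) 3 → ℝ≥0∞, Measurable f → ∫⁻ z, f z ∂μZ = ∫⁻ g, β g * f (toBorelQuotient (↥(maximalRealSubfield L)) L (IsCMField.complexConj L) 3 g) ∂νG)
    -- the M1 family: `φ ∈ V(χ, K, 1)` continuous bounded with `φ ∘ ι_∞ = φ(1)`, and a basis of `V(χʷ, K, 1)` by continuous bounded functions
    {χ : HeckeCharacter L} {K' : Subgroup (quasiSplit (↥(maximalRealSubfield L)) L (IsCMField.complexConj L) 3).Adelic} {ω : ↥K' → ℂ} {φ : (quasiSplit (↥(maximalRealSubfield L)) L (IsCMField.complexConj L) 3).Adelic → ℂ} (hφV : φ ∈ chiSectionSpace χ K' ω) (hφc : Continuous φ) {Mφ : ℝ} (hφM : ∀ x, ‖φ x‖ ≤ Mφ)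
    -- the LEVEL: `K′ ≤ K`, `ι(K_∞) ⊆ K′`, an open compact `U₀` with `ι_f(U₀ ∩ G_f) ⊆ K′` on which `ω = 1`, continuity of the sections; auxiliary Haar measures on `G_∞` (two-sided) and `G(𝔸_f)`
    (hK' : K' ≤ ((standardMaximalCompactGL 3 L).comap (adelicVal (↥(maximalRealSubfield L)) L (IsCMField.complexConj L) 3 ((StdForm.antidiagonal 3).over L)) : Subgroup (quasiSplit (↥(maximalRealSubfield L)) L (IsCMField.complexConj L) 3).Adelic))
    (hKinf : ∀ k : arch (↥(maximalRealSubfield L)) L (IsCMField.complexConj L) 3 ((StdForm.antidiagonal 3).over L), adelicVal (↥(maximalRealSubfield L)) L (IsCMField.complexConj L) 3 ((StdForm.antidiagonal 3).over L) (archToAdelic (↥(maximalRealSubfield L)) L (IsCMField.complexConj L) 3 _ k) ∈ standardMaximalCompactGL 3 L →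
      archToAdelic (↥(maximalRealSubfield L)) L (IsCMField.complexConj L) 3 _ k ∈ K')
    (U₀ : Subgroup (GL (Fin 3) (FiniteAdeleRing (𝓞 L) L))) (hU₀o : IsOpen (U₀ : Set (GL (Fin 3) (FiniteAdeleRing (𝓞 L) L)))) (hU₀c : IsCompact (U₀ : Set (GL (Fin 3) (FiniteAdeleRing (𝓞 L) L))))
    (hU : ∀ b : finAdelic (↥(maximalRealSubfield L)) L (IsCMField.complexConj L) 3 ((StdForm.antidiagonal 3).over L), (b : GL (Fin 3) (FiniteAdeleRing (𝓞 L) L)) ∈ U₀ →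
      ∃ hb : finAdelicToAdelic (↥(maximalRealSubfield L)) L (IsCMField.complexConj L) 3 ((StdForm.antidiagonal 3).over L) b ∈ K', ω ⟨_, hb⟩ = 1)
    (hVc : ∀ φ ∈ chiSectionSpace χ K' ω, Continuous φ)
    (μa : Measure (arch (↥(maximalRealSubfield L)) L (IsCMField.complexConj L) 3 ((StdForm.antidiagonal 3).over L))) [μa.IsHaarMeasure] [μa.IsMulRightInvariant]
    (μf : Measure (finAdelic (↥(maximalRealSubfield L)) L (IsCMField.complexConj L) 3 ((StdForm.antidiagonal 3).over L))) [μf.IsHaarMeasure]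
    {ι' : Type} [Fintype ι'] [DecidableEq ι'] (bV : Module.Basis ι' ℂ ↥(chiSectionSpace (reflectChar (IsCMField.complexConj L) χ) K' ω))
    (hbc : ∀ j, Continuous ((bV j : ↥(chiSectionSpace (reflectChar (IsCMField.complexConj L) χ) K' ω)) : (quasiSplit (↥(maximalRealSubfield L)) L (IsCMField.complexConj L) 3).Adelic → ℂ)) {Mb : ℝ} (hbM : ∀ j x, ‖((bV j : ↥(chiSectionSpace (reflectChar (IsCMField.complexConj L) χ) K' ω)) : (quasiSplit (↥(maximalRealSubfield L)) L (IsCMField.complexConj L) 3).Adelic → ℂ) x‖ ≤ Mb) :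
    ∃ (q : ι' → ℂ → ℂ) (Ec : ℂ → (quasiSplit (↥(maximalRealSubfield L)) L (IsCMField.complexConj L) 3).Adelic → ℂ) (qc : ι' → ℂ → ℂ) (P : Set ℂ),
      (∀ j, DifferentiableOn ℂ (q j) {z : ℂ | 2 < z.re}) ∧
      (∀ z : ℂ, 2 < z.re → (∑ j, q j z • ((bV j : ↥(chiSectionSpace (reflectChar (IsCMField.complexConj L) χ) K' ω)) : (quasiSplit (↥(maximalRealSubfield L)) L (IsCMField.complexConj L) 3).Adelic → ℂ)) = ((((ν 𝓕).toReal⁻¹ : ℝ)) : ℂ) • (fun g : (quasiSplit (↥(maximalRealSubfield L)) L (IsCMField.complexConj L) 3).Adelic => (∫ v : ↥(adelicUnipotent (↥(maximalRealSubfield L)) L (IsCMField.complexConj L) 3), flatSectionU φ z ((quasiSplit (↥(maximalRealSubfield L)) L (IsCMField.complexConj L) 3).toAdelic (weylLongU ((IsCMField.complexConj L : L ≃ₐ[↥(maximalRealSubfield L)] L) : L →+* L) (rfl : (StdForm.antidiagonal 3).over L = (StdForm.antidiagonal 3).over L)) * ((v : (quasiSplit (↥(maximalRealSubfield L)) L (IsCMField.complexConj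 L) 3).Adelic) * g)) ∂ν) * (((borelHeight g : ℝ) : ℂ) ^ (z - 2)))) ∧
      (∀ g, MeromorphicNFOn (fun z => Ec z g) univ) ∧ (∀ j, MeromorphicNFOn (qc j) univ) ∧
      (∀ z : ℂ, 2 < z.re → Ec z = eisensteinSeriesU (flatSectionU φ z)) ∧ (∀ j (z : ℂ), 2 < z.re → qc j z = q j z) ∧
      IsClosed P ∧ (∀ z₀ : ℂ, ∀ᶠ s in 𝓝[≠] z₀, s ∉ P) ∧ (∀ z ∈ P, z.re ≤ 2) ∧
      (∀ g (z : ℂ), z ∉ P → AnalyticAt ℂ (fun z => Ec z g) z) ∧ (∀ j (z : ℂ), z ∉ P → AnalyticAt ℂ (qc j) z) ∧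
      (∀ g, DifferentiableOn ℂ (fun z => Ec z g) Pᶜ) ∧ (∀ j, DifferentiableOn ℂ (qc j) Pᶜ) ∧
      ∀ z : ℂ, z ∉ P → Continuous (Ec z) := by
  classical
  -- the scattering coordinates (★ row 8 M1 §1 `exists_scatteringCoords_of_basis_cm_three_one`, general level)
  obtain ⟨q, hq, hqφ⟩ := exists_scatteringCoords_of_basis_cm_three_one L ν h𝓕N h𝓕c hK' hφV hφc hφM bV
  have hli : LinearIndependent ℂ (fun j => ((bV j : ↥(chiSectionSpace (reflectChar (IsCMField.complexConj L) χ) K' ω)) : (quasiSplit (↥(maximalRealSubfield L)) L (IsCMField.complexConj L) 3).Adelic → ℂ)) :=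
    bV.linearIndependent.map' (Submodule.subtype _) (Submodule.ker_subtype _)
  have hφ'χ : ∀ j, IsChiSection (reflectChar (IsCMField.complexConj L) χ) ((bV j : ↥(chiSectionSpace (reflectChar (IsCMField.complexConj L) χ) K' ω)) : (quasiSplit (↥(maximalRealSubfield L)) L (IsCMField.complexConj L) 3).Adelic → ℂ) := fun j => (bV j).2.1
  -- ONE call of ★ row 6 X2_χ (A)-eigen (`N = 3`, pair currency at `χ₂ = 1`, `V := chiSectionSpace χ K′ ω`) with the general-level ball data (★ row 7b `exists_chi_convData_level_cm_three`) as `hCD`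
  obtain ⟨Ec, qc, P, hE⟩ := chiEisenstein_meromorphic_exports_cm_three_of_letters_of_eigen L μ νG ν h𝓕N h𝓕c h𝓕₀ hβ hμZ (isAutomorphic_one (IsCMField.complexConj L))
    (IsChiSection.isChiSectionPair_of_trivial (one_apply_torus (IsCMField.complexConj L)) (isChiSection_of_mem hφV)) hφV hφc hφM (isAutomorphic_one (IsCMField.complexConj L)) hli hbc
    (fun j => IsChiSection.isChiSectionPair_of_trivial (one_apply_torus (IsCMField.complexConj L)) (hφ'χ j)) hbM q hq hqφ
    fun n => exists_chi_convData_level_cm_three L μ νG hβ hμZ μa μf hK' hKinf U₀ hU₀o hU₀c hU hVc n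
  exact ⟨q, Ec, qc, P, hq, hqφ, hE⟩

end Summit.HodgeConjecture.HodgeConjecture.Cruxes.H413.K2E1ChiEisensteinMeromorphicExportsLevelCMThree
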